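import Summits.QuantumFields.GaugeBoot.ZdCentralTwist
import Literature.Probability.LatticeModels.ONModelProofs
import HarnessLib

/-!
# The `ℤ^d` staggered central twist on the lattice Yang–Mills SPECIFICATION: `𝒢(-β) = T 𝒢(β)`
# (gauge-boot, L3 structural supplement; `ℤ^d` twist 6)

HONEST FRAMING (cell `pub-gaugeboot`, page 1 of every file): the venture produces certified bounds
on lattice expectations at stated coupling, gauge group, dimension and torus size; NOT a mass gap,
NOT a continuum limit, NOT a string tension; NOT Yang–Mills-summit-bearing (barriers
`FixedCouplingUltralocality`, `PerturbativeInvisibility`). This module bounds no expectation; no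
certificate of the cell sits at `β < 0`.

`ZdCentralTwist.lean` carried the ONE-LINK Gibbs identity (`IsHaarShiftState`, the form the
Class-B interface uses) from `β` to `-β` under the Kogut–Susskind twist `T_s` (`ρ z = -1`). Here the
same is done at the level of the full DLR description of the tree
(`Literature.MathematicalPhysics.QuantumLattice.ymSpecification ρ β`, Georgii's specification of
the Wilson action with boundary terms; `ymGibbsMeasures ρ β = 𝒢(β)` its DLR states):

* `centralTwist_glueWith` — the twist intertwines the gluing maps of a finite link set `Λ` with the
  fibrewise left multiplication by the weights, which preserves the product Haar measure on `G^Λ`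
  (`measurePreserving_mulWeights`);
* ★ `IsStaggering.ymSpecification_map_centralTwist` — **covariance of the kernels**:
  `γ^β_Λ(· | η) ∘ T⁻¹ = γ^{-β}_Λ(· | T η)` (the tilt `exp(-β S_Λ)` pulls back to `exp(β S_Λ)` up to
  the constant `exp(-2βN #{p : p ∩ Λ ≠ ∅})`, which the normalisation absorbs; push-forward and
  tilting commute, `Literature.Probability.LatticeModels.map_tilted_comp`);
* ★★ `IsStaggering.isGibbsMeasure_map_centralTwist`, `map_centralTwist_mem_ymGibbsMeasures` —
  **`μ ∈ 𝒢(β) ⇒ μ ∘ T⁻¹ ∈ 𝒢(-β)`** (Georgii 2011, Remark (5.10): a transformation carrying the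
  specification `γ^β` to `γ^{-β}` carries `𝒢(β)` to `𝒢(-β)`); ★★ `mem_ymGibbsMeasures_map_centralTwist_iff`
  — it is a bijection `𝒢(β) ≃ 𝒢(-β)` (`T` is an involution). Any `d`, any compact metrisable `G`
  with a central involution `z`, any continuous `ρ` with `ρ z = -1` (`SU(2)`, `SU(2n)`, `U(N)`),
  every real `β`: the infinite-volume, boundary-condition-free form of Li–Meurice's
  `Z(-β) = e^{2β𝒩_p} Z(β)`.

What is NOT claimed: nothing for `SU(2n+1)`; no statement about which DLR states are translation
invariant or extremal (part 1 handles translation invariance for gauge-invariant states); no bound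
on any expectation. [folklore] bookkeeping (Georgii 2011 §5.1; Li–Meurice 2005 §II; Seiler LNP 159
Ch. 2).
-/

noncomputable section

open MeasureTheory
open Literature.Probability.LatticeModels (Site glueWith glueWith_apply_mem glueWith_apply_not_mem
  measurable_glueWith IsGibbsMeasure map_tilted_comp)
open Literature.MathematicalPhysics.QuantumLattice
open Literature.MathematicalPhysics.QuantumFieldTheory (haarProbability)
open Literature.RepresentationTheory.CompactGroups

namespace Summit.QuantumFields.GaugeBoot

namespace TiltedRP

variable {d N : ℕ} {G : Type*} [Group G]

/-! ## The twist and the gluing maps -/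

section Glue

variable {z : G} {s : ZdEdge d → G}

/-- **The twist intertwines the gluing maps**: `T_s (ζ η_{Λᶜ}) = (s|_Λ · ζ) (T_s η)_{Λᶜ}`. -/
theorem centralTwist_glueWith (s : ZdEdge d → G) (Λ : Finset (ZdEdge d)) (ζ : ↥Λ → G)
    (η : LGConfig d G) :
    centralTwist s (glueWith Λ ζ η) =
      glueWith Λ (fun e : ↥Λ => s (e : ZdEdge d) * ζ e) (centralTwist s η) := by
  funext e
  by_cases he : e ∈ Λ
  · rw [centralTwist_apply, glueWith_apply_mem _ _ _ he, glueWith_apply_mem _ _ _ he]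
  · rw [centralTwist_apply, glueWith_apply_not_mem _ _ _ he, glueWith_apply_not_mem _ _ _ he,
      centralTwist_apply]

variable [TopologicalSpace G] [IsTopologicalGroup G] [CompactSpace G] [MeasurableSpace G]
  [BorelSpace G]

/-- Fibrewise left multiplication by the weights preserves the product Haar measure on `G^Λ`. -/
theorem measurePreserving_mulWeights (s : ZdEdge d → G) (Λ : Finset (ZdEdge d)) :
    MeasurePreserving (fun ζ : ↥Λ → G => fun e : ↥Λ => s (e : ZdEdge d) * ζ e)
      (Measure.pi fun _ : ↥Λ => haarProbability G) (Measure.pi fun _ : ↥Λ => haarProbability G) := by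
  haveI : IsProbabilityMeasure (haarProbability G) :=
    CompactGroup.isProbabilityMeasure_haarMeasure_top
  haveI : (haarProbability G).IsMulLeftInvariant := by
    unfold haarProbability; infer_instance
  exact measurePreserving_pi _ _ fun e : ↥Λ => measurePreserving_mul_left (haarProbability G) (s (e : ZdEdge d))

end Glue

/-! ## Covariance of the specification and of the DLR states -/

section DLR

variable [TopologicalSpace G] [IsTopologicalGroup G] [CompactSpace G] [MeasurableSpace G]
  [BorelSpace G] [SecondCountableTopology G]
variable (ρ : G →* Matrix (Fin N) (Fin N) ℂ) {z : G} {s : ZdEdge d → G}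

/-- ★ **Covariance of the lattice Yang–Mills kernels under the twist**:
`γ^β_Λ(· | η) ∘ T_s⁻¹ = γ^{-β}_Λ(· | T_s η)` for every finite link set `Λ` and boundary condition `η`
(`ρ` continuous with `ρ z = -1`). -/
theorem IsStaggering.ymSpecification_map_centralTwist (hs : IsStaggering (zdUnit d) z s)
    (hρ : Continuous ρ) (hρz : ρ z = -1) (β : ℝ) (Λ : Finset (ZdEdge d)) (η : LGConfig d G) :
    (ymSpecification ρ β Λ η).map (centralTwist s) = ymSpecification ρ (-β) Λ (centralTwist s η) := by
  have hT : Measurable (centralTwist (d := d) s : LGConfig d G → LGConfig d G) :=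
    measurable_centralTwist s
  set C : ℝ := 2 * N * (plaquettesTouching Λ).card with hC
  have hg : Measurable fun U : LGConfig d G => -(-β) * wilsonBoundaryAction ρ Λ U + -(β * C) :=
    ((continuous_const.mul (continuous_wilsonBoundaryAction ρ hρ _)).add continuous_const).measurable
  have hcomp : (fun U : LGConfig d G => -β * wilsonBoundaryAction ρ Λ U) =
      (fun U : LGConfig d G => -(-β) * wilsonBoundaryAction ρ Λ U + -(β * C)) ∘ centralTwist s := by
    funext U
    rw [Function.comp_apply, hs.wilsonBoundaryAction_centralTwist ρ hρz]
    ring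
  -- tilting by `g + c` is tilting by `g`: the constant is absorbed by the normalisation
  have hconst : ∀ (ν : Measure (LGConfig d G)) (g : LGConfig d G → ℝ) (c : ℝ),
      ν.tilted (fun U => g U + c) = ν.tilted g := fun ν g c => by
    unfold Measure.tilted
    congr 1
    funext U
    simp_rw [Real.exp_add]
    rw [integral_mul_const, mul_div_mul_right _ _ (Real.exp_pos c).ne']
  unfold ymSpecification
  rw [hcomp, map_tilted_comp _ hT hg, hconst, Measure.map_map hT (measurable_glueWith Λ η),
    show centralTwist s ∘ (fun ζ : ↥Λ → G => glueWith Λ ζ η) =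
      (fun ζ : ↥Λ → G => glueWith Λ ζ (centralTwist s η)) ∘
        (fun ζ : ↥Λ → G => fun e : ↥Λ => s (e : ZdEdge d) * ζ e)
      from funext fun ζ => centralTwist_glueWith s Λ ζ η,
    ← Measure.map_map (measurable_glueWith Λ _) (measurePreserving_mulWeights s Λ).measurable,
    (measurePreserving_mulWeights s Λ).map_eq]

/-- ★★ **The twist carries DLR states at `β` to DLR states at `-β`**: if `μ` satisfies the DLR
equations of the Wilson specification at `β`, then `μ ∘ T_s⁻¹` satisfies them at `-β`
(Georgii 2011, Remark (5.10)). -/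
theorem IsStaggering.isGibbsMeasure_map_centralTwist (hs : IsStaggering (zdUnit d) z s)
    (hρ : Continuous ρ) (hρz : ρ z = -1) {β : ℝ} {μ : Measure (LGConfig d G)}
    (hμ : IsGibbsMeasure (ymSpecification ρ β) μ) :
    IsGibbsMeasure (ymSpecification ρ (-β)) (μ.map (centralTwist s)) := by
  have hT : Measurable (centralTwist (d := d) s : LGConfig d G → LGConfig d G) :=
    measurable_centralTwist s
  haveI := hμ.1
  refine ⟨Measure.isProbabilityMeasure_map hT.aemeasurable, fun Λ A hA => ?_⟩
  have h1 : ∫⁻ η, ymSpecification ρ (-β) Λ η A ∂μ.map (centralTwist s) =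
      ∫⁻ η, ymSpecification ρ (-β) Λ (centralTwist s η) A ∂μ :=
    lintegral_map_equiv _ hs.centralTwistEquiv
  have h2 : ∀ η, ymSpecification ρ (-β) Λ (centralTwist s η) A =
      ymSpecification ρ β Λ η (centralTwist s ⁻¹' A) := fun η => by
    rw [← hs.ymSpecification_map_centralTwist ρ hρ hρz β Λ η, Measure.map_apply hT hA]
  rw [h1]
  simp_rw [h2]
  rw [hμ.2 _ _ (hT hA), Measure.map_apply hT hA]

/-- ★★ **`T 𝒢(β) ⊆ 𝒢(-β)`.** -/
theorem IsStaggering.map_centralTwist_mem_ymGibbsMeasures (hs : IsStaggering (zdUnit d) z s)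
    (hρ : Continuous ρ) (hρz : ρ z = -1) {β : ℝ} {μ : Measure (LGConfig d G)}
    (hμ : μ ∈ ymGibbsMeasures ρ β) : μ.map (centralTwist s) ∈ ymGibbsMeasures ρ (-β) :=
  hs.isGibbsMeasure_map_centralTwist ρ hρ hρz hμ

/-- ★★ **`𝒢(-β) = T 𝒢(β)`**: `μ ∘ T⁻¹ ∈ 𝒢(β) ↔ μ ∈ 𝒢(-β)` (the twist is an involution). -/
theorem IsStaggering.mem_ymGibbsMeasures_map_centralTwist_iff (hs : IsStaggering (zdUnit d) z s)
    (hρ : Continuous ρ) (hρz : ρ z = -1) (β : ℝ) (μ : Measure (LGConfig d G)) :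
    μ.map (centralTwist s) ∈ ymGibbsMeasures ρ β ↔ μ ∈ ymGibbsMeasures ρ (-β) := by
  refine ⟨fun h => ?_, fun h => by simpa using hs.map_centralTwist_mem_ymGibbsMeasures ρ hρ hρz h⟩
  have h' := hs.map_centralTwist_mem_ymGibbsMeasures ρ hρ hρz h
  rwa [← eq_map_centralTwist_map_centralTwist hs μ] at h'

end DLR

end TiltedRP

end Summit.QuantumFields.GaugeBoot
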